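import Mathlib.Topology.Instances.AddCircle.Real
import Mathlib.Analysis.Normed.Group.AddCircle
import Mathlib.Analysis.Normed.Module.Connected
import Mathlib.Analysis.InnerProductSpace.PiL2
import Mathlib.Topology.OpenPartialHomeomorph.Constructions
import Mathlib.Geometry.Manifold.IsManifold.Basic
import Mathlib.Geometry.Manifold.ContMDiff.NormedSpace
import HarnessLib

/-!
# Flat tori `E/Φ(ℤ^ι)` as real-analytic manifolds charted on `E`; the (punctured) standard
# `n`-torus over `EuclideanSpace ℝ (Fin n)`

The `n`-torus `𝕋ⁿ = ℝⁿ/ℤⁿ = (ℝ/ℤ)ⁿ` is a compact connected real-analytic `n`-manifold: charts are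
local inverses of the covering map `π : ℝⁿ → 𝕋ⁿ`, transition maps are integer translations
(J. M. Lee, *Introduction to Smooth Manifolds*, 2nd ed. (2012), Examples 1.9, 1.34, 21.14 (a)).
This file is the REAL twin of `Literature.Geometry.Kaehler.ComplexTorus` (same presentation and
proofs, `ℂ ↦ ℝ`): for a finite type `ι`, a real normed space `E` and `Φ : (ι → ℝ) ≃L[ℝ] E`
(a basis of the lattice `Φ(ℤ^ι)`),

* `FlatTorus Φ` — type synonym of Mathlib's `UnitAddTorus ι = ι → AddCircle (1 : ℝ)` (topology,
  group, compactness, Hausdorffness, path-connectedness, second countability are Mathlib's),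
  CHARTED ON `E` by `FlatTorus.chart Φ a` = inverse of `mk ∘ Φ⁻¹` on the box
  `Φ(∏ᵢ (aᵢ, aᵢ + 1))`; transition maps are locally `z ↦ z - Φ(n)`, `n ∈ ℤ^ι`
  (`eventuallyEq_chart_mk_symm`), whence `instIsManifold : IsManifold 𝓘(ℝ, E) ω` (so `C^∞`
  and every `Cⁿ` through Mathlib's instances); `instNontrivial`;
* `FlatTorus.mk Φ` — the covering map: `mk_surjective`, `mk_eq_mk_iff` (fibres are the
  cosets of `ℤ^ι`), `countable_mk_preimage_singleton`, `contMDiff_mk_comp_symm`,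
  `contMDiff_mk` (real analytic);
* `FlatTorus.punctured Φ p : Opens (FlatTorus Φ)` — `𝕋 ∖ {p}` as an open submanifold (Mathlib's
  `Opens` instances: `ChartedSpace E`, `IsManifold`, `T2Space`, `SecondCountableTopology`);
  `isPathConnected_compl_singleton`, `connectedSpace_punctured`: (path) connected when `#ι > 1`
  (image under `mk` of the complement of the countable fibre, which is path connected by
  Mathlib's `Set.Countable.isPathConnected_compl_of_one_lt_rank`);
* `FlatTorus.stdFrame n : (Fin n → ℝ) ≃L[ℝ] EuclideanSpace ℝ (Fin n)`, `StdTorus n := FlatTorus (stdFrame n)`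
  (`ChartedSpace (EuclideanSpace ℝ (Fin n))`, `IsManifold (𝓡 n) ω`, compact, connected, T₂, second
  countable) and `PuncturedStdTorus n p` (a `ConnectedSpace` for `n = m + 2`, instance).

Consumer: the negative lane of the final state conjecture's crux `MaximalCensorship` needs the
"admissible non-PSC" data manifold `X = 𝕋³ ∖ {p}` of Isenberg–Mazzeo–Pollack (Ann. Henri Poincaré
4 (2003) 369, Thm. 1, Thm. 4; Witt 1986) with the binders `[ChartedSpace E3 X]
[IsManifold (𝓡 3) ∞ X] [T2Space X] [SecondCountableTopology X] [ConnectedSpace X]` — all found by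
instance search on `PuncturedStdTorus 3 p` — and the closed `Σ = StdTorus 3` over `E3` to state the
positive-scalar-curvature obstruction (Schoen–Yau 1979; IMP 2003, Thm. 4) in the tree's vocabulary.

Mathlib (pinned) has `AddCircle`/`UnitAddTorus` (topology, normed group, `openPartialHomeomorphCoe`)
but no manifold structure on tori (`Circle` is one via the sphere; products are charted on
`ModelProd`, not `ℝⁿ`; `Instances/Quotient.lean` stops at the charted space); nothing here
duplicates Mathlib, all instances live on new type synonyms. NOT here: the flat metric and the
local-isometry property of `mk`, the Lie group structure, the identification with the orbit
space `ℝⁿ/ℤⁿ`, asymptotically flat ends of the punctured torus.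

## References

* J. M. Lee, *Introduction to Smooth Manifolds*, 2nd ed., GTM 218 (2012), Examples 1.9, 1.34,
  21.14 (a). [LeeSmoothManifolds2013]
* A. Kosinski, *Differential Manifolds* (1993), VI.1.1 (`M ∖ {p}` connected if `dim M > 1`).
  [Kosinski1993]
* J. Isenberg, R. Mazzeo, D. Pollack, *On the topology of vacuum spacetimes*, Ann. Henri Poincaré
  4 (2003) 369–383, Thm. 1, Thm. 4 (the consumer). [IsenbergMazzeoPollack2002]
-/

noncomputable section

open scoped Manifold ContDiff Topology
open Set Filter Function

namespace Literature.Geometry.Manifold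

variable {ι : Type*} {E : Type*} [NormedAddCommGroup E] [NormedSpace ℝ E]

/-- **The flat torus** `E / Φ(ℤ^ι)` attached to a continuous real-linear isomorphism
`Φ : ℝ^ι ≃ E` (the columns `Φ(eᵢ)` are a basis of the lattice): as a type, Mathlib's real torus
`UnitAddTorus ι = ι → AddCircle (1 : ℝ) = (ℝ/ℤ)^ι`; the manifold structure (charts valued in `E`)
makes `z ↦ mk (Φ⁻¹ z) : E → E/Φ(ℤ^ι)` a local real-analytic diffeomorphism (Lee (2012), Examples 1.9,
21.14 (a): `𝕋ⁿ = ℝⁿ/ℤⁿ`). [cite: LeeSmoothManifolds2013, Example 21.14 (a)] -/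
@[nolint unusedArguments]
def FlatTorus (_Φ : (ι → ℝ) ≃L[ℝ] E) : Type _ := UnitAddTorus ι

namespace FlatTorus

variable (Φ : (ι → ℝ) ≃L[ℝ] E)

/-- The topology of the real torus `(ℝ/ℤ)^ι`. [folklore] -/
instance instTopologicalSpace : TopologicalSpace (FlatTorus Φ) := inferInstanceAs (TopologicalSpace (UnitAddTorus ι))

/-- The group structure of the real torus `(ℝ/ℤ)^ι`. [folklore] -/
instance instAddCommGroup : AddCommGroup (FlatTorus Φ) := inferInstanceAs (AddCommGroup (UnitAddTorus ι))

/-- The real torus is a topological group. [folklore] -/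
instance instIsTopologicalAddGroup : IsTopologicalAddGroup (FlatTorus Φ) := inferInstanceAs (IsTopologicalAddGroup (UnitAddTorus ι))

/-- A flat torus is Hausdorff. [folklore] -/
instance instT2Space : T2Space (FlatTorus Φ) := inferInstanceAs (T2Space (UnitAddTorus ι))

/-- A flat torus is compact (Lee (2012), Example 1.9). [cite: LeeSmoothManifolds2013, Example 1.9] -/
instance instCompactSpace : CompactSpace (FlatTorus Φ) := inferInstanceAs (CompactSpace (UnitAddTorus ι))

/-- A flat torus is path connected (it is a quotient of a vector space). [folklore] -/
instance instPathConnectedSpace : PathConnectedSpace (FlatTorus Φ) := inferInstanceAs (PathConnectedSpace (UnitAddTorus ι))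

/-- The covering map `π : ℝ^ι → (ℝ/ℤ)^ι`, in the real coordinates of the lattice basis
(Lee (2012), Example 21.14 (a)). [cite: LeeSmoothManifolds2013, Example 21.14 (a)] -/
def mk (x : ι → ℝ) : FlatTorus Φ := fun i ↦ ((x i : ℝ) : AddCircle (1 : ℝ))

/-- The covering map is continuous. [folklore] -/
theorem continuous_mk : Continuous (mk Φ) :=
  continuous_pi fun i ↦ (AddCircle.continuous_mk' (1 : ℝ)).comp (continuous_apply i)

/-- The standard lift `(ℝ/ℤ)^ι → [0, 1)^ι ⊂ ℝ^ι` (a discontinuous section of `mk`). [folklore] -/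
def lift (t : FlatTorus Φ) : ι → ℝ := fun i ↦ (AddCircle.equivIco (1 : ℝ) 0 (t i) : ℝ)

/-- `lift` is a section of the covering map. [folklore] -/
@[simp] theorem mk_lift (t : FlatTorus Φ) : mk Φ (lift Φ t) = t :=
  funext fun _ ↦ AddCircle.coe_equivIco

/-- The covering map is surjective. [folklore] -/
theorem mk_surjective : Surjective (mk Φ) :=
  fun t ↦ ⟨lift Φ t, mk_lift Φ t⟩

/-- **The fibres of the covering map are the cosets of `ℤ^ι`**: `mk x = mk y ↔ y = x + n`, `n ∈ ℤ^ι`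
(Lee (2012), Example 21.14 (a): `mk` "makes the same identifications as the quotient map
`ℝⁿ → ℝⁿ/ℤⁿ`"). [cite: LeeSmoothManifolds2013, Example 21.14 (a)] -/
theorem mk_eq_mk_iff (x y : ι → ℝ) :
    mk Φ x = mk Φ y ↔ ∃ n : ι → ℤ, y = x + fun i ↦ (n i : ℝ) := by
  constructor
  · intro h
    have hi : ∀ i, ∃ n : ℤ, y i = x i + n := by
      intro i
      have h1 : ((y i : ℝ) : AddCircle (1 : ℝ)) = ((x i : ℝ) : AddCircle (1 : ℝ)) :=
        (congr_fun h i).symm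
      have h0 : (((y i - x i : ℝ)) : AddCircle (1 : ℝ)) = 0 := by
        rw [AddCircle.coe_sub, h1, sub_self]
      obtain ⟨n, hn⟩ := (AddCircle.coe_eq_zero_iff (1 : ℝ)).1 h0
      rw [zsmul_eq_mul, mul_one] at hn
      exact ⟨n, by linarith⟩
    choose n hn using hi
    exact ⟨n, funext hn⟩
  · rintro ⟨n, rfl⟩
    funext i
    have h0 : ((n i : ℝ) : AddCircle (1 : ℝ)) = 0 := by
      rw [AddCircle.coe_eq_zero_iff]
      exact ⟨n i, by rw [zsmul_eq_mul, mul_one]⟩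
    show ((x i : ℝ) : AddCircle (1 : ℝ)) = (((x i + (n i : ℝ) : ℝ)) : AddCircle (1 : ℝ))
    rw [AddCircle.coe_add, h0, add_zero]

/-- `x` and `x - 1/2` are distinct modulo `1` (local helper). [folklore] -/
private theorem coe_ne_coe_sub_half (x : ℝ) :
    ((x : ℝ) : AddCircle (1 : ℝ)) ≠ ((x - 2⁻¹ : ℝ) : AddCircle (1 : ℝ)) := by
  intro h
  have h' : (((x - (x - 2⁻¹) : ℝ)) : AddCircle (1 : ℝ)) = 0 := by
    rw [AddCircle.coe_sub, h, sub_self]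
  obtain ⟨n, hn⟩ := (AddCircle.coe_eq_zero_iff (1 : ℝ)).1 h'
  rw [zsmul_eq_mul, mul_one, sub_sub_cancel] at hn
  have h2 : ((2 * n : ℤ) : ℝ) = 1 := by push_cast; rw [hn]; norm_num
  have h3 : (2 * n : ℤ) = 1 := by exact_mod_cast h2
  omega

/-- A flat torus of positive dimension has more than one point (`mk (1/2, …) ≠ mk 0`). [folklore] -/
instance instNontrivial [Nonempty ι] : Nontrivial (FlatTorus Φ) := by
  obtain ⟨i⟩ := ‹Nonempty ι›
  refine ⟨⟨mk Φ (fun _ ↦ 2⁻¹), mk Φ 0, fun h ↦ ?_⟩⟩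
  have h1 : (((2⁻¹ : ℝ)) : AddCircle (1 : ℝ)) = ((0 : ℝ) : AddCircle (1 : ℝ)) := congr_fun h i
  have h2 := coe_ne_coe_sub_half (2⁻¹ : ℝ)
  rw [sub_self] at h2
  exact h2 h1

/-- The fibre of the covering map over a point is countable (a coset `x₀ + ℤ^ι`). [folklore] -/
theorem countable_mk_preimage_singleton [Finite ι] (p : FlatTorus Φ) :
    (mk Φ ⁻¹' {p}).Countable := by
  have hsub : mk Φ ⁻¹' {p} ⊆ range fun n : ι → ℤ ↦ lift Φ p + fun i ↦ (n i : ℝ) := by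
    intro x hx
    have hx' : mk Φ (lift Φ p) = mk Φ x := by rw [mk_lift]; exact hx.symm
    obtain ⟨n, hn⟩ := (mk_eq_mk_iff Φ _ _).1 hx'
    exact ⟨n, hn.symm⟩
  exact (countable_range _).mono hsub

/-! ### The punctured torus -/

/-- **The punctured flat torus** `E/Φ(ℤ^ι) ∖ {p}` as an open submanifold (Mathlib's `Opens` instances:
charted on `E`, Hausdorff, second countable); the topology `Σ ∖ {p}`, `Σ = 𝕋ⁿ`, of IMP (2003). [folklore] -/
def punctured (p : FlatTorus Φ) : TopologicalSpace.Opens (FlatTorus Φ) :=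
  ⟨{p}ᶜ, isOpen_compl_singleton⟩

/-- Membership in the punctured torus. [folklore] -/
@[simp] theorem mem_punctured_iff {p x : FlatTorus Φ} : x ∈ punctured Φ p ↔ x ≠ p := Iff.rfl

/-- The carrier of the punctured torus is `{p}ᶜ`. [folklore] -/
@[simp] theorem coe_punctured (p : FlatTorus Φ) : (punctured Φ p : Set (FlatTorus Φ)) = {p}ᶜ := rfl

variable [Fintype ι]

/-- A flat torus is second countable (finite product of second countable spaces). [folklore] -/
instance instSecondCountableTopology : SecondCountableTopology (FlatTorus Φ) := inferInstanceAs (SecondCountableTopology (UnitAddTorus ι))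

/-- The real box chart with corner `a`: the covering map restricted to the open box
`∏ᵢ (aᵢ, aᵢ + 1)`, a homeomorphism onto `{t | ∀ i, tᵢ ≠ aᵢ mod 1}` (product of Mathlib's
`AddCircle.openPartialHomeomorphCoe`). [folklore] -/
def boxChart (a : ι → ℝ) : OpenPartialHomeomorph (ι → ℝ) (FlatTorus Φ) :=
  OpenPartialHomeomorph.pi fun i ↦ AddCircle.openPartialHomeomorphCoe (1 : ℝ) (a i)

/-- **The charts**: `chart Φ a` is the inverse of `mk ∘ Φ⁻¹` on the open box
`Φ(∏ᵢ (aᵢ, aᵢ + 1)) ⊂ E`, i.e. `t ↦ Φ(x)` with `x` the unique lift of `t` in that box (Lee (2012),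
Example 21.14 (a): local sections of the covering map). [cite: LeeSmoothManifolds2013, Example 21.14 (a)] -/
def chart (a : ι → ℝ) : OpenPartialHomeomorph (FlatTorus Φ) E :=
  (boxChart Φ a).symm.transHomeomorph Φ.toHomeomorph

/-- The chart sends `t` to `Φ` of its lift in the box `∏ᵢ [aᵢ, aᵢ + 1)`. [folklore] -/
theorem chart_apply (a : ι → ℝ) (t : FlatTorus Φ) :
    chart Φ a t = Φ (fun i ↦ (AddCircle.equivIco (1 : ℝ) (a i) (t i) : ℝ)) :=
  rfl

/-- The inverse of every chart is (a restriction of) the SAME map `mk ∘ Φ⁻¹ : E → E/Φ(ℤ^ι)`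
(definitionally). [folklore] -/
theorem chart_symm_eq_mk_comp_symm (a : ι → ℝ) : ((chart Φ a).symm : E → FlatTorus Φ) = mk Φ ∘ Φ.symm :=
  rfl

/-- `t` lies in the domain of `chart Φ a` iff `tᵢ ≠ aᵢ mod 1` for every `i`. [folklore] -/
theorem mem_chart_source_iff {a : ι → ℝ} {t : FlatTorus Φ} :
    t ∈ (chart Φ a).source ↔ ∀ i, t i ≠ ((a i : ℝ) : AddCircle (1 : ℝ)) :=
  ⟨fun h i ↦ h i (mem_univ i), fun h i _ ↦ h i⟩

/-- The corner of the preferred chart at `t`: `lift t - (1/2, …, 1/2)`. [folklore] -/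
def corner (t : FlatTorus Φ) : ι → ℝ := fun i ↦ lift Φ t i - 2⁻¹

/-- **The charted space structure** of the flat torus: atlas `{chart Φ a | a ∈ ℝ^ι}`, preferred
chart at `t` the box of half-width `1/2` centred at the standard lift of `t` (Lee (2012),
Example 21.14 (a); Huybrechts (2005), §2.1 for the same atlas on complex tori). [cite: LeeSmoothManifolds2013, Example 21.14 (a)] -/
instance instChartedSpace : ChartedSpace E (FlatTorus Φ) where
  atlas := Set.range (chart Φ)
  chartAt t := chart Φ (corner Φ t)
  mem_chart_source t := by
    refine (mem_chart_source_iff Φ).2 fun i ↦ ?_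
    have ht : t i = ((lift Φ t i : ℝ) : AddCircle (1 : ℝ)) := (AddCircle.coe_equivIco).symm
    rw [ht]
    exact coe_ne_coe_sub_half (lift Φ t i)
  chart_mem_atlas t := Set.mem_range_self _

/-- The preferred chart at `t` (definitional). [folklore] -/
theorem chartAt_eq (t : FlatTorus Φ) : chartAt E t = chart Φ (corner Φ t) := rfl

/-- The atlas (definitional). [folklore] -/
theorem atlas_eq : atlas E (FlatTorus Φ) = Set.range (chart Φ) := rfl

/-- **The covering map read in a chart is locally a translation by a lattice vector**: near a point
`z₀` over the domain of `chart Φ a`, `chart Φ a ∘ mk ∘ Φ⁻¹` is `z ↦ z - Φ(n)` with `n ∈ ℤ^ι` the vector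
moving `Φ⁻¹ z₀` into `∏ᵢ [aᵢ, aᵢ + 1)`; as every inverse chart is `mk ∘ Φ⁻¹`, these are also the
transition maps (Lee (2012), Example 21.14 (a); computation as in the complex twin
`Literature.Geometry.Kaehler.ComplexTorus.eventuallyEq_chart_symm_trans`). [cite: LeeSmoothManifolds2013, Example 21.14 (a)] -/
theorem eventuallyEq_chart_mk_symm {a : ι → ℝ} {z₀ : E}
    (h : ∀ i, ((Φ.symm z₀ i : ℝ) : AddCircle (1 : ℝ)) ≠ ((a i : ℝ) : AddCircle (1 : ℝ))) :
    (fun z ↦ chart Φ a (mk Φ (Φ.symm z))) =ᶠ[𝓝 z₀]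
      fun z ↦ z - Φ (fun i ↦ (toIcoDiv zero_lt_one (a i) (Φ.symm z₀ i) : ℝ)) := by
  set n : ι → ℝ := fun i ↦ (toIcoDiv zero_lt_one (a i) (Φ.symm z₀ i) : ℝ) with hn
  -- the reduction of `Φ⁻¹ z₀` lies in the OPEN box
  have hIoo : ∀ i, Φ.symm z₀ i - n i ∈ Ioo (a i) (a i + 1) := by
    intro i
    have hmod : Φ.symm z₀ i - n i = toIcoMod zero_lt_one (a i) (Φ.symm z₀ i) := by
      rw [← self_sub_toIcoDiv_zsmul, zsmul_eq_mul, mul_one]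
    have hne : toIcoMod zero_lt_one (a i) (Φ.symm z₀ i) ≠ a i := by
      intro h'
      exact h i (AddCommGroup.modEq_iff_eq_mod_zmultiples.1
        ((AddCommGroup.modEq_iff_toIcoMod_eq_left zero_lt_one).2 h')).symm
    rw [hmod]
    exact ⟨lt_of_le_of_ne (toIcoMod_mem_Ico _ _ _).1 hne.symm, (toIcoMod_mem_Ico _ _ _).2⟩
  -- hence so does the same translate of `Φ⁻¹ z` for `z` near `z₀`
  have hev : ∀ᶠ z in 𝓝 z₀, ∀ i, Φ.symm z i - n i ∈ Ioo (a i) (a i + 1) := by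
    refine Filter.eventually_all.2 fun i ↦ ?_
    have hc : Continuous fun z ↦ Φ.symm z i - n i :=
      ((continuous_apply i).comp Φ.symm.continuous).sub continuous_const
    exact hc.continuousAt.eventually_mem (isOpen_Ioo.mem_nhds (hIoo i))
  filter_upwards [hev] with z hz
  rw [chart_apply]
  have key : (fun i ↦ (AddCircle.equivIco (1 : ℝ) (a i) (mk Φ (Φ.symm z) i) : ℝ)) =
      Φ.symm z - n := by
    funext i
    change toIcoMod zero_lt_one (a i) (Φ.symm z i) = Φ.symm z i - n i
    rw [toIcoMod_eq_iff]
    exact ⟨Ioo_subset_Ico_self (hz i), toIcoDiv zero_lt_one (a i) (Φ.symm z₀ i),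
      by rw [zsmul_eq_mul, mul_one, hn]; ring⟩
  rw [key, map_sub, ContinuousLinearEquiv.apply_symm_apply]

/-- Over the domain of `chart Φ a`, the covering map read in the chart, `chart Φ a ∘ mk ∘ Φ⁻¹`, is
real analytic (locally a translation). [cite: LeeSmoothManifolds2013, Example 21.14 (a)] -/
theorem contDiffAt_chart_mk_symm {a : ι → ℝ} {z₀ : E}
    (h : ∀ i, ((Φ.symm z₀ i : ℝ) : AddCircle (1 : ℝ)) ≠ ((a i : ℝ) : AddCircle (1 : ℝ))) :
    ContDiffAt ℝ ω (fun z ↦ chart Φ a (mk Φ (Φ.symm z))) z₀ :=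
  (contDiffAt_id.sub contDiffAt_const).congr_of_eventuallyEq (eventuallyEq_chart_mk_symm Φ h)

/-- Hence every transition map `chart Φ a ∘ (chart Φ a₀)⁻¹` is real analytic on its domain (the
inverse chart being `mk ∘ Φ⁻¹`). [cite: LeeSmoothManifolds2013, Example 21.14 (a)] -/
theorem contDiffAt_chart_symm_trans {a : ι → ℝ} {z₀ : E}
    (h : ∀ i, ((Φ.symm z₀ i : ℝ) : AddCircle (1 : ℝ)) ≠ ((a i : ℝ) : AddCircle (1 : ℝ)))
    (a₀ : ι → ℝ) :
    ContDiffAt ℝ ω ((chart Φ a) ∘ (chart Φ a₀).symm) z₀ := by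
  rw [chart_symm_eq_mk_comp_symm]
  exact contDiffAt_chart_mk_symm Φ h

/-- **A flat torus is a real-analytic manifold** modelled on `E` (hence `C^∞` and `Cⁿ` for every
`n`, by Mathlib's `IsManifold` instances): the transition maps of the atlas are locally
translations. Lee (2012), Example 1.34 and Example 21.14 (a). [cite: LeeSmoothManifolds2013, Example 21.14 (a)] -/
instance instIsManifold : IsManifold 𝓘(ℝ, E) ω (FlatTorus Φ) := by
  refine isManifold_of_contDiffOn _ _ _ ?_
  rintro e e' ⟨a₀, rfl⟩ ⟨a, rfl⟩
  simp only [modelWithCornersSelf_coe, modelWithCornersSelf_coe_symm, CompTriple.comp_eq, range_id,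
    inter_univ, preimage_id_eq, id_eq]
  intro z hz
  have hz' := (mem_chart_source_iff Φ).1 (hz.2 : (chart Φ a₀).symm z ∈ (chart Φ a).source)
  exact (contDiffAt_chart_symm_trans Φ (fun i ↦ hz' i) a₀).contDiffWithinAt

/-- For `x` in the domain of `chart Φ a`, `Φ⁻¹ (chart Φ a x)` is a lift of `x`. [folklore] -/
theorem mk_symm_chart {a : ι → ℝ} {x : FlatTorus Φ} (hx : x ∈ (chart Φ a).source) :
    mk Φ (Φ.symm (chart Φ a x)) = x :=
  (chart Φ a).left_inv hx

/-- **The covering map is real analytic**: `mk ∘ Φ⁻¹ : E → E/Φ(ℤ^ι)` read in any chart is locally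
a translation (Lee (2012), Example 21.14 (a): a smooth covering map). [cite: LeeSmoothManifolds2013, Example 21.14 (a)] -/
theorem contMDiff_mk_comp_symm : ContMDiff 𝓘(ℝ, E) 𝓘(ℝ, E) ω (mk Φ ∘ Φ.symm) := by
  intro z₀
  rw [contMDiffAt_iff_target]
  refine ⟨((continuous_mk Φ).comp Φ.symm.continuous).continuousAt, ?_⟩
  rw [contMDiffAt_iff_contDiffAt]
  have h : ∀ i, ((Φ.symm z₀ i : ℝ) : AddCircle (1 : ℝ)) ≠
      ((corner Φ (mk Φ (Φ.symm z₀)) i : ℝ) : AddCircle (1 : ℝ)) := by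
    have hmem := mem_chart_source E (mk Φ (Φ.symm z₀))
    rw [chartAt_eq] at hmem
    exact fun i ↦ (mem_chart_source_iff Φ).1 hmem i
  have hfun : (extChartAt 𝓘(ℝ, E) ((mk Φ ∘ Φ.symm) z₀) ∘ mk Φ ∘ Φ.symm : E → E) =
      fun z ↦ chart Φ (corner Φ (mk Φ (Φ.symm z₀))) (mk Φ (Φ.symm z)) := by
    funext z
    simp [chartAt_eq]
  rw [hfun]
  exact contDiffAt_chart_mk_symm Φ h

/-- The covering map `mk : ℝ^ι → E/Φ(ℤ^ι)` itself is real analytic (`= (mk ∘ Φ⁻¹) ∘ Φ`).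
[cite: LeeSmoothManifolds2013, Example 21.14 (a)] -/
theorem contMDiff_mk : ContMDiff 𝓘(ℝ, ι → ℝ) 𝓘(ℝ, E) ω (mk Φ) := by
  have h : mk Φ = (mk Φ ∘ Φ.symm) ∘ (Φ : (ι → ℝ) → E) := by
    funext x
    simp
  rw [h]
  exact (contMDiff_mk_comp_symm Φ).comp Φ.toContinuousLinearMap.contMDiff

/-- **Removing a point from a torus of dimension `≥ 2` leaves it path connected**: `𝕋 ∖ {p}` is the
image under `mk` of the complement of the countable fibre `x₀ + ℤ^ι` in `ℝ^ι`, path connected when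
`dim > 1` (Mathlib's `Set.Countable.isPathConnected_compl_of_one_lt_rank`; Kosinski (1993), VI.1.1). [folklore] -/
theorem isPathConnected_compl_singleton (hι : 1 < Fintype.card ι) (p : FlatTorus Φ) :
    IsPathConnected ({p}ᶜ : Set (FlatTorus Φ)) := by
  have hrank : 1 < Module.rank ℝ (ι → ℝ) := by
    rw [rank_fun']
    exact_mod_cast hι
  have hpc := ((countable_mk_preimage_singleton Φ p).isPathConnected_compl_of_one_lt_rank
    hrank).image (f := mk Φ) (continuous_mk Φ)
  have himage : mk Φ '' (mk Φ ⁻¹' {p})ᶜ = {p}ᶜ := by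
    rw [← preimage_compl, image_preimage_eq _ (mk_surjective Φ)]
  rwa [himage] at hpc

/-- The punctured torus of dimension `≥ 2` is a connected space. [folklore] -/
theorem connectedSpace_punctured (hι : 1 < Fintype.card ι) (p : FlatTorus Φ) :
    ConnectedSpace (punctured Φ p) :=
  haveI : PathConnectedSpace (punctured Φ p) :=
    isPathConnected_iff_pathConnectedSpace.1 (isPathConnected_compl_singleton Φ hι p)
  inferInstance

end FlatTorus

/-! ### The standard tori over Euclidean space -/

/-- The standard frame `ℝⁿ ≃ EuclideanSpace ℝ (Fin n)` (the identity on underlying functions,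
Mathlib's `EuclideanSpace.equiv` reversed): the lattice basis of the standard torus `ℝⁿ/ℤⁿ`.
[folklore] -/
abbrev FlatTorus.stdFrame (n : ℕ) : (Fin n → ℝ) ≃L[ℝ] EuclideanSpace ℝ (Fin n) :=
  (EuclideanSpace.equiv (Fin n) ℝ).symm

/-- **The standard `n`-torus `𝕋ⁿ = ℝⁿ/ℤⁿ`**: a compact connected Hausdorff second countable real-analytic
`n`-manifold CHARTED ON `EuclideanSpace ℝ (Fin n)` (`IsManifold (𝓡 n) ω`; the tree's model of
`3`-manifolds for `n = 3`). Lee (2012), Examples 1.9, 1.34, 21.14 (a). [cite: LeeSmoothManifolds2013, Example 1.34] -/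
abbrev StdTorus (n : ℕ) : Type := FlatTorus (FlatTorus.stdFrame n)

/-- **The punctured standard `n`-torus `𝕋ⁿ ∖ {p}`**, an open submanifold of `StdTorus n` (charted on
`EuclideanSpace ℝ (Fin n)`, Hausdorff, second countable; connected for `n ≥ 2`, instance below); for
`n = 3` the data manifold `T³ ∖ {p}` of Isenberg–Mazzeo–Pollack (2003), Thm. 1/4, Witt (1986). [folklore] -/
abbrev PuncturedStdTorus (n : ℕ) (p : StdTorus n) : Type := FlatTorus.punctured (FlatTorus.stdFrame n) p

/-- The punctured standard torus of dimension `m + 2 ≥ 2` is connected (instance form of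
`FlatTorus.connectedSpace_punctured`). [folklore] -/
instance instConnectedSpacePuncturedStdTorus (m : ℕ) (p : StdTorus (m + 2)) :
    ConnectedSpace (PuncturedStdTorus (m + 2) p) :=
  FlatTorus.connectedSpace_punctured _ (by simp) p

end Literature.Geometry.Manifold
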